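import Summits.MatrixMultiplication.MatrixMultiplication.Theorems.LevelGradedCohnUmansLevelOneGL2DesignsTangencyPlaneUnitalIntegrality
import Summits.MatrixMultiplication.MatrixMultiplication.Theorems.LevelGradedCohnUmansLevelOneGL2DesignsTangencyPolarityPG

/-!
# The unital theorems in the plane of the stub, `PG(2,p)` — stub `stub_tangencySets` (crux
`LevelOneGL2Designs`, stmt-MatrixMultiplication-14080), wall-breaker axis 10/12 "Hermitian unital
constructions", generation 1 (seat 3), part 5 (instantiation)

Parts 1–4 (`…TangencyPlaneUnital`, `…Converse`, `…Integrality`, `…Dual`) are stated for an abstract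
`Configuration.ProjectivePlane`.  This file reads them in Mathlib's model `ℙ K (Fin 3 → K)` of the
Desarguesian plane `PG(2,K)` (`Configuration.ofField`: incidence = orthogonality), whose order is `|K|`
(`BaerPolarity.order_projectivization`, axis k7), and in particular in `PG(2,p)`, the projective
closure of the affine plane over `ZMod p` in which `stub_tangencySets` lives (its flags embed with no
loss, `ProjectiveChart.projective_srs_of_stub_srs`: `T(p) ≤ SRS(p)`):

* `srs_card_sub_one_sq_lt_pg` — over a finite field of non-square order every strong representative
  system of `PG(2,K)` has `(|S| − 1)² < |K|³` (the unital size `|K|^{3/2} + 1` is never reached);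
* `srs_card_sub_one_sq_lt_pg_zmod` — the case `K = ZMod p`, `p` prime: `(|S| − 1)² < p³`;
* `srs_card_le_pg_zmod_eleven`, `…_thirteen` — `SRS(11) ≤ 36`, `SRS(13) ≤ 46` for `PG(2,11)`,
  `PG(2,13)` (ISW: `37`, `47`; siege census: `≥ 35`, `≥ 42`);
* `srs_type_pg_zmod_seven` — an SRS of `PG(2,7)` of the extremal size `19` (it exists: the cyclic
  semioval, a Singer orbit) is of type `(1,3,4)`.

Nothing here is more than instantiation; it is recorded so that the numbers of the wall's census
(DECOMPOSITIONS.md §2) can be quoted against theorems about `PG(2,p)` itself.  No definitions.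
-/

-- `Summit.MatrixMultiplication.MatrixMultiplication.…` is the tree's mandated summit/problem namespace (D-0017).
set_option linter.dupNamespace false

namespace Summit.MatrixMultiplication.MatrixMultiplication.Theorems.LevelOneGL2Designs.PlaneUnital

open scoped LinearAlgebra.Projectivization
open Finset Configuration Projectivization
open Summit.MatrixMultiplication.MatrixMultiplication.Theorems.LevelOneGL2Designs.BaerPolarity
  (order_projectivization not_isSquare_prime)

section PG

variable (K : Type*) [Field K] [Fintype K] [DecidableEq K]

/-- **Strict ISW in `PG(2,K)`, `|K|` not a square.**  Every strong representative system `S` of the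
Desarguesian plane over a finite field of non-square order (flags `(x, ℓ)` of `ℙ K (Fin 3 → K)` with
`x ∈ ℓ' ↔ (x, ℓ) = (x', ℓ')`) has `(|S| − 1)² < |K|³`. [Thas 1974; Illés–Szőnyi–Wettl 1991
(corollary), via `srs_card_sub_one_sq_lt_of_not_isSquare` and `order_projectivization`] -/
theorem srs_card_sub_one_sq_lt_pg (hK : ¬ IsSquare (Fintype.card K))
    (S : Finset (ℙ K (Fin 3 → K) × ℙ K (Fin 3 → K)))
    (hS : ∀ f ∈ S, ∀ g ∈ S, (f.1 ∈ g.2 ↔ f = g)) :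
    (S.card - 1) ^ 2 < Fintype.card K ^ 3 := by
  classical
  haveI : Fintype (ℙ K (Fin 3 → K)) := Fintype.ofFinite _
  have h := srs_card_sub_one_sq_lt_of_not_isSquare (P := ℙ K (Fin 3 → K)) (L := ℙ K (Fin 3 → K))
    (by rw [order_projectivization]; exact hK) S hS
  rwa [order_projectivization] at h

end PG

section Prime

variable (p : ℕ) [hp : Fact p.Prime]

/-- **Strict ISW in the plane of the stub.**  In `PG(2,p)`, `p` prime, every strong representative
system has `(|S| − 1)² < p³`: the bound `p√p + 1` of the Hermitian-unital heuristic is never attained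
(equality would force a unital, hence `√p ∈ ℕ`). [Thas 1974; Illés–Szőnyi–Wettl 1991 (corollary)] -/
theorem srs_card_sub_one_sq_lt_pg_zmod
    (S : Finset (ℙ (ZMod p) (Fin 3 → ZMod p) × ℙ (ZMod p) (Fin 3 → ZMod p)))
    (hS : ∀ f ∈ S, ∀ g ∈ S, (f.1 ∈ g.2 ↔ f = g)) :
    (S.card - 1) ^ 2 < p ^ 3 := by
  have h := srs_card_sub_one_sq_lt_pg (ZMod p) (by rw [ZMod.card]; exact not_isSquare_prime p) S hS
  rwa [ZMod.card] at h

/-- **`SRS(11) ≤ 36` in `PG(2,11)`** (ISW: `37`; census of the wall: `SRS(11) ≥ 35`).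
[elementary, `srs_card_le_of_order_eq_eleven`] -/
theorem srs_card_le_pg_zmod_eleven (h11 : p = 11)
    (S : Finset (ℙ (ZMod p) (Fin 3 → ZMod p) × ℙ (ZMod p) (Fin 3 → ZMod p)))
    (hS : ∀ f ∈ S, ∀ g ∈ S, (f.1 ∈ g.2 ↔ f = g)) : S.card ≤ 36 := by
  classical
  haveI : Fintype (ℙ (ZMod p) (Fin 3 → ZMod p)) := Fintype.ofFinite _
  refine srs_card_le_of_order_eq_eleven ?_ S hS
  rw [order_projectivization, ZMod.card, h11]

/-- **`SRS(13) ≤ 46` in `PG(2,13)`** (ISW: `47`; census of the wall: `SRS(13) ≥ 42`).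
[elementary, `srs_card_le_of_order_eq_thirteen`] -/
theorem srs_card_le_pg_zmod_thirteen (h13 : p = 13)
    (S : Finset (ℙ (ZMod p) (Fin 3 → ZMod p) × ℙ (ZMod p) (Fin 3 → ZMod p)))
    (hS : ∀ f ∈ S, ∀ g ∈ S, (f.1 ∈ g.2 ↔ f = g)) : S.card ≤ 46 := by
  classical
  haveI : Fintype (ℙ (ZMod p) (Fin 3 → ZMod p)) := Fintype.ofFinite _
  refine srs_card_le_of_order_eq_thirteen ?_ S hS
  rw [order_projectivization, ZMod.card, h13]

open scoped Classical in
/-- **Extremal systems of `PG(2,7)` are of type `(1,3,4)`.**  A strong representative system of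
`PG(2,7)` with `19 = ⌊7√7 + 1⌋` flags (the cyclic semioval attains this) meets every line other than
its `19` tangents in `3` or `4` points. [elementary, `srs_type_of_order_eq_seven`; Kiss 2008 p. 20] -/
theorem srs_type_pg_zmod_seven (h7 : p = 7)
    (S : Finset (ℙ (ZMod p) (Fin 3 → ZMod p) × ℙ (ZMod p) (Fin 3 → ZMod p)))
    (hS : ∀ f ∈ S, ∀ g ∈ S, (f.1 ∈ g.2 ↔ f = g)) (h19 : S.card = 19) :
    ∀ ℓ : ℙ (ZMod p) (Fin 3 → ZMod p), ℓ ∉ S.image Prod.snd →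
      (S.filter fun f => f.1 ∈ ℓ).card = 3 ∨ (S.filter fun f => f.1 ∈ ℓ).card = 4 := by
  haveI : Fintype (ℙ (ZMod p) (Fin 3 → ZMod p)) := Fintype.ofFinite _
  refine srs_type_of_order_eq_seven ?_ S hS h19
  rw [order_projectivization, ZMod.card, h7]

end Prime

end Summit.MatrixMultiplication.MatrixMultiplication.Theorems.LevelOneGL2Designs.PlaneUnital
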